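import Summits.CriticalPhenomena.PercolationContinuityZ3.Theorems.PercNearOneGluingNoHeavyLowerTailKnQuestion8CoefficientwiseCoreClassKernelMixBiDiscipline
import Summits.CriticalPhenomena.PercolationContinuityZ3.Theorems.PercNearOneGluingNoHeavyLowerTailKnQuestion8CoefficientwiseCoreClassKernelMixReducedKleitman

/-!
# Cycle words: the strict Kleitman inequality (LEMMA C) and bi-disciplined bijections

Support file (`--supports stmt-CriticalPhenomena-4575`, closed), prover `prim-cplus-coupling` (gen 66).  No notations, no named facts, no sorries;
standard axioms.  Memo `prim-cplus-coupling/A5-COUPLING-gen66.md` §3 (LEMMA C) and §1.1.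

The colourings of a cycle `C_L` through the hub are modelled by WORDS `w = (h₁, μ, h_L) : Bool × Finset α × Bool`: the two HUB letters (`true` = red)
and the set `μ` of red INTERIOR edges (`α` = the interior edges; no cyclic order is needed).  Order = componentwise (more red is larger), mirror
`cw (h₁, μ, h_L) = (¬h₁, μᶜ, ¬h_L)`, full word `⊤ = (true, univ, true)`, `y⁰ = (false, univ, false)`.  A LEVEL (the minimal abstraction of an exact level
of the cycle, memo §3 Remark (b)) is a lower family `V` of non-full words which, if nonempty, contains the two single-hub words `(true, ∅, false)`,
`(false, ∅, true)` (same blue hub-cluster as the empty word) and which contains a word with both hub letters red only if it is everything (`Y = ∅`).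
* `strict_kleitman_cycleWord` (LEMMA C): for a level `V ≠ NF`, nonempty, and a nonempty upper family `U` with `y⁰ ∉ U`:  `#(U ∩ V) + 1 ≤ #{t ∈ U | cw t ∈ V}`
  — by slicing along the hub pattern and `BiDiscipline.bidiscipline_core`.
* `kleitman_cycleWord`: plain Kleitman `#(U ∩ V) ≤ #{t ∈ U | cw t ∈ V}` on the word lattice (tensorization `ReducedKleitman.isNSpace_prod`).
* `exists_bidisciplined_injection`: for every level `V ≠ NF` there is an increasing injective `φ : V → mirror(V)` whose preimage of the full word lies
  below `y⁰` (Hall's theorem) — the single-cycle input of the two-type theorem.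
[cite: KozmaNitzan2024, Questions 8–9 (§5.5 p. 36) (context); Harris 1960; Kleitman 1966]
-/

namespace Summit.CriticalPhenomena.PercolationContinuityZ3.Theorems.Coefficientwise.CycleWords

open Finset BiDiscipline ReducedKleitman JoinMatching

variable {α : Type*} [Fintype α] [DecidableEq α]

/-- The mirror (complement) of a cycle word. -/
def cw (w : Bool × Finset α × Bool) : Bool × Finset α × Bool := (!w.1, (w.2.1ᶜ, !w.2.2))

/-- Components of the mirror. -/
@[simp] theorem cw_apply (a : Bool) (μ : Finset α) (b : Bool) : cw (a, (μ, b)) = (!a, (μᶜ, !b)) := rfl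

/-- The mirror is an involution. -/
@[simp] theorem cw_cw (w : Bool × Finset α × Bool) : cw (cw w) = w := by
  obtain ⟨a, μ, b⟩ := w; simp [cw]

/-- The slice of a family of words at hub pattern `(a, b)`: the interior sets occurring with these hub letters. -/
def slice (S : Finset (Bool × Finset α × Bool)) (a b : Bool) : Finset (Finset α) := univ.filter (fun μ => (a, (μ, b)) ∈ S)

/-- Membership in a slice. -/
@[simp] theorem mem_slice {S : Finset (Bool × Finset α × Bool)} {a b : Bool} {μ : Finset α} :
    μ ∈ slice S a b ↔ (a, (μ, b)) ∈ S := by simp [slice]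

/-- A family of words is counted by its four hub slices. -/
theorem card_eq_sum_slices (S : Finset (Bool × Finset α × Bool)) :
    S.card = (slice S false false).card + (slice S true false).card + (slice S false true).card + (slice S true true).card := by
  classical
  have h := card_eq_sum_card_fiberwise (f := fun w : Bool × Finset α × Bool => (w.1, w.2.2)) (s := S)
    (t := (univ : Finset (Bool × Bool))) (fun _ _ => mem_univ _)
  have hfib : ∀ ab : Bool × Bool, (S.filter (fun w => (w.1, w.2.2) = ab)).card = (slice S ab.1 ab.2).card := by
    rintro ⟨a0, b0⟩
    refine card_bij (fun w _ => w.2.1) ?_ ?_ ?_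
    · intro w hw
      obtain ⟨hwS, hab⟩ := mem_filter.mp hw
      rw [mem_slice]
      have : (a0, (w.2.1, b0)) = w := by
        obtain ⟨a, μ, b⟩ := w; simp only [Prod.mk.injEq] at hab; obtain ⟨rfl, rfl⟩ := hab; rfl
      rw [this]; exact hwS
    · intro w hw w' hw' h
      obtain ⟨_, hab⟩ := mem_filter.mp hw
      obtain ⟨_, hab'⟩ := mem_filter.mp hw'
      obtain ⟨a, μ, b⟩ := w; obtain ⟨a', μ', b'⟩ := w'
      simp only [Prod.mk.injEq] at hab hab' h ⊢
      exact ⟨hab.1.trans hab'.1.symm, h, hab.2.trans hab'.2.symm⟩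
    · intro μ hμ
      exact ⟨(a0, (μ, b0)), mem_filter.mpr ⟨mem_slice.mp hμ, rfl⟩, rfl⟩
  rw [h, sum_congr rfl (fun ab _ => hfib ab), Fintype.sum_prod_type]
  simp only [Fintype.sum_bool]
  ring

/-- Slices of an intersection. -/
theorem slice_inter (S T : Finset (Bool × Finset α × Bool)) (a b : Bool) : slice (S ∩ T) a b = slice S a b ∩ slice T a b := by
  ext μ; simp [slice, mem_inter]

/-- Slices of the mirror-filter `{t ∈ U | cw t ∈ V}`. -/
theorem slice_filter_cw (U V : Finset (Bool × Finset α × Bool)) (a b : Bool) :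
    slice (U.filter (fun t => cw t ∈ V)) a b = (slice U a b).filter (fun μ => μᶜ ∈ slice V (!a) (!b)) := by
  ext μ; simp [slice, cw]

/-- Slices of an upper family are upper families. -/
theorem isUpperSet_slice {U : Finset (Bool × Finset α × Bool)} (hU : IsUpperSet (U : Set (Bool × Finset α × Bool))) (a b : Bool) :
    IsUpperSet ((slice U a b : Finset (Finset α)) : Set (Finset α)) := by
  intro μ ν hμν hμ
  rw [mem_coe, mem_slice] at hμ ⊢
  exact hU (show ((a, (μ, b)) : Bool × Finset α × Bool) ≤ (a, (ν, b)) from ⟨le_rfl, hμν, le_rfl⟩) hμ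

/-- Slices of a lower family are lower families. -/
theorem isLowerSet_slice {V : Finset (Bool × Finset α × Bool)} (hV : IsLowerSet (V : Set (Bool × Finset α × Bool))) (a b : Bool) :
    IsLowerSet ((slice V a b : Finset (Finset α)) : Set (Finset α)) := by
  intro μ ν hνμ hμ
  rw [mem_coe, mem_slice] at hμ ⊢
  exact hV (show ((a, (ν, b)) : Bool × Finset α × Bool) ≤ (a, (μ, b)) from ⟨le_rfl, hνμ, le_rfl⟩) hμ

/-- In an upper family the slices grow with the hub letters. -/
theorem slice_mono_upper {U : Finset (Bool × Finset α × Bool)} (hU : IsUpperSet (U : Set (Bool × Finset α × Bool)))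
    {a b a' b' : Bool} (ha : a ≤ a') (hb : b ≤ b') : slice U a b ⊆ slice U a' b' := by
  intro μ hμ
  rw [mem_slice] at hμ ⊢
  exact hU (show ((a, (μ, b)) : Bool × Finset α × Bool) ≤ (a', (μ, b')) from ⟨ha, le_rfl, hb⟩) hμ

/-- In a lower family the slices shrink with the hub letters. -/
theorem slice_mono_lower {V : Finset (Bool × Finset α × Bool)} (hV : IsLowerSet (V : Set (Bool × Finset α × Bool)))
    {a b a' b' : Bool} (ha : a ≤ a') (hb : b ≤ b') : slice V a' b' ⊆ slice V a b := by
  intro μ hμ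
  rw [mem_slice] at hμ ⊢
  exact hV (show ((a, (μ, b)) : Bool × Finset α × Bool) ≤ (a', (μ, b')) from ⟨ha, le_rfl, hb⟩) hμ

/-- A LEVEL of the cycle-word lattice (minimal abstraction of an exact level): a lower family of non-full words which, if nonempty, contains the
two single-hub words, and which contains a word with both hub letters red only if it contains every non-full word. -/
def IsLevel (V : Finset (Bool × Finset α × Bool)) : Prop :=
  IsLowerSet (V : Set (Bool × Finset α × Bool)) ∧ (true, ((univ : Finset α), true)) ∉ V ∧
    (V.Nonempty → (true, ((∅ : Finset α), false)) ∈ V ∧ (false, ((∅ : Finset α), true)) ∈ V) ∧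
    ((∃ μ : Finset α, (true, (μ, true)) ∈ V) → ∀ w : Bool × Finset α × Bool, w ≠ (true, (univ, true)) → w ∈ V)

/-- **LEMMA C (strict Kleitman for cycle words).**  For a nonempty level `V` that misses some non-full word, and a nonempty upper family `U` not
containing `y⁰ = (false, univ, false)`:  `#(U ∩ V) + 1 ≤ #{t ∈ U | cw t ∈ V}`.  Memo gen 66 §3. -/
theorem strict_kleitman_cycleWord (V U : Finset (Bool × Finset α × Bool)) (hV : IsLevel V) (hVne : V.Nonempty)
    (hVnf : ∃ w : Bool × Finset α × Bool, w ≠ (true, (univ, true)) ∧ w ∉ V)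
    (hU : IsUpperSet (U : Set (Bool × Finset α × Bool))) (hUne : U.Nonempty) (hy0 : (false, ((univ : Finset α), false)) ∉ U) :
    (U ∩ V).card + 1 ≤ (U.filter (fun t => cw t ∈ V)).card := by
  classical
  obtain ⟨hVlow, hVtop, hVhub, hVRR⟩ := hV
  -- U has no BB words
  have hUBB : slice U false false = ∅ := by
    ext μ
    refine ⟨fun hμ => ?_, fun h => absurd h (by simp)⟩
    rw [mem_slice] at hμ
    exact (hy0 (hU (show ((false, (μ, false)) : Bool × Finset α × Bool) ≤ (false, (univ, false)) from
      ⟨le_rfl, subset_univ μ, le_rfl⟩) hμ)).elim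
  -- V has no RR words (else V = NF, contradicting hVnf)
  have hVRR' : slice V true true = ∅ := by
    ext μ
    refine ⟨fun hμ => ?_, fun h => absurd h (by simp)⟩
    rw [mem_slice] at hμ
    obtain ⟨w, hw, hwV⟩ := hVnf
    exact (hwV (hVRR ⟨μ, hμ⟩ w hw)).elim
  -- the core inequality on the interior lattice
  obtain ⟨hRB, hBR⟩ := hVhub hVne
  have key := bidiscipline_core (slice U true false) (slice U false true) (slice U true true)
    (slice V true false) (slice V false true) (slice V false false)
    (isUpperSet_slice hU true false) (isUpperSet_slice hU false true) (isUpperSet_slice hU true true)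
    (isLowerSet_slice hVlow true false) (isLowerSet_slice hVlow false true)
    (slice_mono_upper hU le_rfl (by decide)) (slice_mono_upper hU (by decide) le_rfl)
    (slice_mono_lower hVlow (by decide) le_rfl) (slice_mono_lower hVlow le_rfl (by decide))
    (mem_slice.mpr hRB) (mem_slice.mpr hBR) ?_
  · -- assemble via the slice decompositions
    rw [card_eq_sum_slices (U ∩ V), card_eq_sum_slices (U.filter (fun t => cw t ∈ V))]
    simp only [slice_inter, slice_filter_cw, hUBB, hVRR', empty_inter, inter_empty, card_empty, Bool.not_false, Bool.not_true,
      filter_empty, zero_add, add_zero]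
    linarith [key]
  · -- R = slice U true true is nonempty: push any word of U up to hub pattern RR
    obtain ⟨w, hw⟩ := hUne
    refine ⟨w.2.1, mem_slice.mpr (hU ?_ hw)⟩
    obtain ⟨a, μ, b⟩ := w
    exact ⟨le_top, le_rfl, le_top⟩

section Kleitman

variable {X Y : Type*} [Fintype X] [DecidableEq X] [Preorder X] [Fintype Y] [DecidableEq Y] [Preorder Y]

omit [Fintype X] in
/-- Left fibres of a lower family of a product are lower families. -/
theorem isLowerSet_fibL {W : Finset (X × Y)} (hW : IsLowerSet (W : Set (X × Y))) (x : X) :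
    IsLowerSet ((fibL W x : Finset Y) : Set Y) := by
  intro a b hba ha
  rw [mem_coe, mem_fibL] at ha ⊢
  exact hW (Prod.mk_le_mk.mpr ⟨le_rfl, hba⟩) ha

omit [Fintype Y] in
/-- Right fibres of a lower family of a product are lower families. -/
theorem isLowerSet_fibR {W : Finset (X × Y)} (hW : IsLowerSet (W : Set (X × Y))) (y : Y) :
    IsLowerSet ((fibR W y : Finset X) : Set X) := by
  intro a b hba ha
  rw [mem_coe, mem_fibR] at ha ⊢
  exact hW (Prod.mk_le_mk.mpr ⟨hba, le_rfl⟩) ha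

end Kleitman

/-- Kleitman in mirror form on `Finset α`, in the `(N)`-space format with trivial reduction. -/
theorem isNSpace_finset : IsNSpace (X := Finset α) compl id (fun W => IsLowerSet (W : Set (Finset α))) := by
  intro U W hU hW
  refine le_trans (kleitman_mirror U W hU hW) (card_le_card ?_)
  intro x hx
  obtain ⟨hxU, hxW⟩ := mem_filter.mp hx
  exact mem_rho.mpr ⟨hxU, hxW, hxU⟩

/-- **Kleitman's inequality on the cycle-word lattice** (mirror form): for an upper family `U` and a lower family `V`,
`#(U ∩ V) ≤ #{t ∈ U | cw t ∈ V}`.  By tensorization (`isNSpace_prod`) of the Boolean-lattice and one-letter cases. -/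
theorem kleitman_cycleWord (U V : Finset (Bool × Finset α × Bool)) (hU : IsUpperSet (U : Set (Bool × Finset α × Bool)))
    (hV : IsLowerSet (V : Set (Bool × Finset α × Bool))) : (U ∩ V).card ≤ (U.filter (fun t => cw t ∈ V)).card := by
  classical
  have hinner := isNSpace_prod (X := Finset α) (Y := Bool) (fun _ => le_rfl) isNSpace_finset isNSpace_free
  have h := isNSpace_prod (X := Bool) (Y := Finset α × Bool) (fun _ => le_rfl) isNSpace_free hinner
  have hvalid : ProdValid (fun W : Finset Bool => IsLowerSet (W : Set Bool))
      (ProdValid (fun W : Finset (Finset α) => IsLowerSet (W : Set (Finset α))) (fun W : Finset Bool => IsLowerSet (W : Set Bool))) V := by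
    refine ⟨fun a => ⟨fun μ => isLowerSet_fibL (isLowerSet_fibL hV a) μ, fun b => isLowerSet_fibR (isLowerSet_fibL hV a) b⟩,
      fun yb => isLowerSet_fibR hV yb⟩
  refine le_trans (h U V hU hvalid) (card_le_card ?_)
  intro w hw
  obtain ⟨hwU, hwV, _⟩ := mem_rho.mp hw
  refine mem_filter.mpr ⟨hwU, ?_⟩
  obtain ⟨a, μ, b⟩ := w
  simpa [cw, Prod.map] using hwV

/-- **Bi-disciplined increasing injections exist** (memo gen 66 §3, Hall ⇒ bijection).  For a nonempty level `V` missing some non-full word there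
is a map `φ`, injective on `V`, with `y ≤ φ y`, `cw (φ y) ∈ V`, and `φ y = ⊤ ⇒ y ≤ y⁰` (the full word is the image only of sources blue at both hub
edges).  Since `#V = #mirror(V)` this is a bijection onto the mirror. -/
theorem exists_bidisciplined_injection (V : Finset (Bool × Finset α × Bool)) (hV : IsLevel V) (hVne : V.Nonempty)
    (hVnf : ∃ w : Bool × Finset α × Bool, w ≠ (true, (univ, true)) ∧ w ∉ V) :
    ∃ φ : (Bool × Finset α × Bool) → (Bool × Finset α × Bool), Set.InjOn φ (V : Set (Bool × Finset α × Bool)) ∧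
      ∀ y ∈ V, y ≤ φ y ∧ cw (φ y) ∈ V ∧ (φ y = (true, (univ, true)) → y ≤ (false, (univ, false))) := by
  classical
  set top : Bool × Finset α × Bool := (true, (univ, true)) with htop
  set y0 : Bool × Finset α × Bool := (false, (univ, false)) with hy0
  have hVlow : IsLowerSet (V : Set (Bool × Finset α × Bool)) := hV.1
  have hle_top : ∀ w : Bool × Finset α × Bool, w ≤ top := by
    rintro ⟨a, μ, b⟩; exact ⟨le_top, subset_univ μ, le_top⟩
  have hctop : cw top ∈ V := by
    -- cw top = bottom word, below any element of V
    obtain ⟨v, hv⟩ := hVne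
    have : cw top ≤ v := by
      obtain ⟨a, μ, b⟩ := v
      rw [htop, cw_apply]
      exact ⟨bot_le, by simp, bot_le⟩
    exact hVlow this hv
  let t : V → Finset (Bool × Finset α × Bool) := fun y =>
    univ.filter (fun x => (y : Bool × Finset α × Bool) ≤ x ∧ cw x ∈ V ∧ (x = top → (y : Bool × Finset α × Bool) ≤ y0))
  have hHall : ∀ s : Finset V, s.card ≤ (s.biUnion t).card := by
    intro s
    by_cases hs : s = ∅
    · simp [hs]
    set S' : Finset (Bool × Finset α × Bool) := s.image (fun y : V => (y : Bool × Finset α × Bool)) with hS'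
    have hcard : s.card = S'.card := by rw [hS', card_image_of_injective _ Subtype.val_injective]
    set U : Finset (Bool × Finset α × Bool) := univ.filter (fun x => ∃ y ∈ S', y ≤ x) with hU
    have hmemU : ∀ {x}, x ∈ U ↔ ∃ y ∈ S', y ≤ x := by intro x; simp [hU]
    have hUup : IsUpperSet (U : Set (Bool × Finset α × Bool)) := by
      intro a b hab ha
      obtain ⟨y, hy, hya⟩ := hmemU.mp (mem_coe.mp ha)
      exact mem_coe.mpr (hmemU.mpr ⟨y, hy, le_trans hya hab⟩)
    have hS'V : S' ⊆ U ∩ V := by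
      intro y hy
      refine mem_inter.mpr ⟨hmemU.mpr ⟨y, hy, le_rfl⟩, ?_⟩
      obtain ⟨y', _, rfl⟩ := mem_image.mp hy
      exact y'.2
    have hS'ne : S'.Nonempty := by
      rw [hS']; exact (nonempty_iff_ne_empty.mpr hs).image _
    have hUne : U.Nonempty := ⟨_, (mem_inter.mp (hS'V hS'ne.choose_spec)).1⟩
    by_cases hlow : ∃ y ∈ S', y ≤ y0
    · -- some source may use the full word: the whole mirror filter is available
      obtain ⟨yl, hyl, hyl0⟩ := hlow
      have hsub : U.filter (fun x => cw x ∈ V) ⊆ s.biUnion t := by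
        intro x hx
        obtain ⟨hxU, hcx⟩ := mem_filter.mp hx
        by_cases hxt : x = top
        · obtain ⟨y', hy', rfl⟩ := mem_image.mp hyl
          refine mem_biUnion.mpr ⟨y', hy', mem_filter.mpr ⟨mem_univ _, ?_, hcx, fun _ => hyl0⟩⟩
          rw [hxt]; exact hle_top _
        · obtain ⟨y, hy, hyx⟩ := hmemU.mp hxU
          obtain ⟨y', hy', rfl⟩ := mem_image.mp hy
          exact mem_biUnion.mpr ⟨y', hy', mem_filter.mpr ⟨mem_univ _, hyx, hcx, fun h => absurd h hxt⟩⟩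
      calc s.card = S'.card := hcard
        _ ≤ (U ∩ V).card := card_le_card hS'V
        _ ≤ (U.filter (fun x => cw x ∈ V)).card := kleitman_cycleWord U V hUup hVlow
        _ ≤ (s.biUnion t).card := card_le_card hsub
    · -- no source below y⁰: then y⁰ ∉ U and the strict inequality pays for the forbidden full word
      have hy0U : y0 ∉ U := by
        intro h
        obtain ⟨y, hy, hyy0⟩ := hmemU.mp h
        exact hlow ⟨y, hy, hyy0⟩
      have hsub : (U.filter (fun x => cw x ∈ V)).erase top ⊆ s.biUnion t := by
        intro x hx
        obtain ⟨hxt, hx'⟩ := mem_erase.mp hx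
        obtain ⟨hxU, hcx⟩ := mem_filter.mp hx'
        obtain ⟨y, hy, hyx⟩ := hmemU.mp hxU
        obtain ⟨y', hy', rfl⟩ := mem_image.mp hy
        exact mem_biUnion.mpr ⟨y', hy', mem_filter.mpr ⟨mem_univ _, hyx, hcx, fun h => absurd h hxt⟩⟩
      have hstrict := strict_kleitman_cycleWord V U hV hVne hVnf hUup hUne hy0U
      calc s.card = S'.card := hcard
        _ ≤ (U ∩ V).card := card_le_card hS'V
        _ ≤ (U.filter (fun x => cw x ∈ V)).card - 1 := by omega
        _ ≤ ((U.filter (fun x => cw x ∈ V)).erase top).card := pred_card_le_card_erase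
        _ ≤ (s.biUnion t).card := card_le_card hsub
  obtain ⟨f, hfinj, hft⟩ := (all_card_le_biUnion_card_iff_exists_injective t).1 hHall
  refine ⟨fun x => if h : x ∈ V then f ⟨x, h⟩ else x, ?_, ?_⟩
  · intro a ha b hb hab
    have ha' : a ∈ V := mem_coe.mp ha
    have hb' : b ∈ V := mem_coe.mp hb
    simp only [ha', hb', dif_pos] at hab
    exact congrArg Subtype.val (hfinj hab)
  · intro y hy
    have hmem := hft ⟨y, hy⟩
    simp only [hy, dif_pos]
    obtain ⟨_, h1, h2, h3⟩ := mem_filter.mp hmem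
    exact ⟨h1, h2, h3⟩

end Summit.CriticalPhenomena.PercolationContinuityZ3.Theorems.Coefficientwise.CycleWords
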